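import Summits.CriticalPhenomena.PercolationContinuityZ3.Theorems.Transplant.FKConnectivityAllQAntipodalTwoSpinePBridge
import Summits.CriticalPhenomena.PercolationContinuityZ3.Theorems.Transplant.FKConnectivityAllQAntipodalTwoSpineDualRule
import Summits.CriticalPhenomena.PercolationContinuityZ3.Theorems.Transplant.FKConnectivityAllQAntipodalTwoSpineSeriesCore
import HarnessLib

/-!
# Conjecture U¹¹ at every PARALLEL split node: `apUpcSplit q (A ∪ B) s t y z h ≥ 0` (`0 < q ≤ 1`)

Helper file (`--supports stmt-CriticalPhenomena-4575`), FK sub-lane `prim-bschramm-fk-2` (gen 16); builds on p205010 (kernel theorem,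
internal audit signed; external expert review pending).  No named facts, no sorries, standard axioms.

Memo `bschramm/FROM-fk-2-g15-TWO-SPINE.md` §12.1/§12.3 and blueprint `prim-bschramm-fk-2-g15/BLUEPRINT-U11-LEAN.md` L3/L4.
**`FK.TwoSpine.apUpcSplit_parallel_core_nonneg`**: `A ∋ y` and `B ∋ z` two-terminal series–parallel between the SAME terminals `s, t`,
each grown from its marked edge along a spine, edge-disjoint with vertex spans meeting only in `{s, t}` (the parallel composition
`A ∥ B`, a PARALLEL SPLIT NODE of the marked pair); then for `0 < q ≤ 1` and every `h` monotone on the sub-configurations of `A ∪ B`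
not reading `y, z`, `0 ≤ apUpcSplit q (A ∪ B) s t y z h`.  PROOF: constant shift (`apUpcSplit_add_const`), the parallel bridge
`apUpcSplit_parallel_bridge` (`…TwoSpinePBridge`), admissibility of the two-spine fibre sums (`admissible_fiber2`), and the PARALLEL-top
rule theorem `dstmt_root_P` (`…TwoSpineDualRule`, word duality from the series rule).  `apUpcSplit_nonneg_of_parallel_core` adds the
decomposition nodes above the split node (gen 14's closure lemmas).
[cite: Grimmett2006, §1.4 eq. (1.20) (p. 15); §3.8 (pp. 61–62); §3.9 (p. 63)]
-/

noncomputable section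

namespace Summit.CriticalPhenomena.PercolationContinuityZ3.Theorems

namespace FK

namespace TwoSpine

open SimpleGraph Literature.Probability.LatticeModels Literature.Probability.Percolation X2Word
open scoped Classical

variable {V : Type*} [Fintype V]

section Core

variable {psA psB : List (SpinePart V)} {A B : Finset (Sym2 V)} {V₁ V₂ : Set V} {y₁ y₂ z₁ z₂ s t : V}

/-- **CONJECTURE U¹¹ AT EVERY PARALLEL SPLIT NODE** (`0 < q ≤ 1`, all spine shapes): for the parallel composition `A ∥ B` of a network
`A ∋ y` and a network `B ∋ z` between the same terminals, each two-terminal series–parallel and grown from its marked edge along a spine,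
and every `h` monotone on the sub-configurations of `A ∪ B` not reading `y, z`: `0 ≤ apUpcSplit q (A ∪ B) s t y z h`. [cite: Grimmett2006, §3.9 (p. 63)] -/
theorem apUpcSplit_parallel_core_nonneg {q : ℝ} (hq0 : 0 < q) (hq1 : q ≤ 1)
    (hA : IsSpine psA {s(y₁, y₂)} y₁ y₂ A s t) (hB : IsSpine psB {s(z₁, z₂)} z₁ z₂ B s t)
    (hy : y₁ ≠ y₂) (hz : z₁ ≠ z₂) (hd : Disjoint A B)
    (h₁ : ∀ e ∈ (↑A : Set (Sym2 V)), ∀ x ∈ e, x ∈ V₁) (h₂ : ∀ e ∈ (↑B : Set (Sym2 V)), ∀ x ∈ e, x ∈ V₂)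
    (hS : V₁ ∩ V₂ ⊆ {s, t}) (hst : s ≠ t)
    {h : Finset (Sym2 V) → ℝ} (hmono : ∀ ⦃C D : Finset (Sym2 V)⦄, C ⊆ D → D ⊆ A ∪ B → h C ≤ h D)
    (hhy : ∀ C, h (insert s(y₁, y₂) C) = h C) (hhz : ∀ C, h (insert s(z₁, z₂) C) = h C) :
    0 ≤ apUpcSplit q (A ∪ B) s t s(y₁, y₂) s(z₁, z₂) h := by
  have hyA : s(y₁, y₂) ∈ A := marked_mem hA
  have hzB : s(z₁, z₂) ∈ B := marked_mem hB
  rw [← apUpcSplit_add_const q (Finset.mem_union_left B hyA) (Finset.mem_union_right A hzB) s t h (-h ∅)]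
  have hhy' : ∀ C, (fun γ => h γ + -h ∅) (insert s(y₁, y₂) C) = (fun γ => h γ + -h ∅) C := fun C => by simp only [hhy]
  have hhz' : ∀ C, (fun γ => h γ + -h ∅) (insert s(z₁, z₂) C) = (fun γ => h γ + -h ∅) C := fun C => by simp only [hhz]
  have hsub : A.erase s(y₁, y₂) ∪ B.erase s(z₁, z₂) ⊆ A ∪ B :=
    Finset.union_subset_union (Finset.erase_subset _ _) (Finset.erase_subset _ _)
  have hmono' : ∀ ⦃C D : Finset (Sym2 V)⦄, C ⊆ D → D ⊆ A.erase s(y₁, y₂) ∪ B.erase s(z₁, z₂) →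
      (fun γ => h γ + -h ∅) C ≤ (fun γ => h γ + -h ∅) D := by
    intro C D hCD hD
    simp only [add_le_add_iff_right]
    exact hmono hCD (hD.trans hsub)
  have hnn' : ∀ C ⊆ A.erase s(y₁, y₂) ∪ B.erase s(z₁, z₂), 0 ≤ (fun γ => h γ + -h ∅) C := by
    intro C hC
    have := hmono (Finset.empty_subset C) (hC.trans hsub)
    simp only
    linarith
  have key := apUpcSplit_parallel_bridge q hA hB hy hz hd h₁ h₂ hS hst (h := fun γ => h γ + -h ∅) hhy' hhz'
  have hadm := admissible_fiber2 hq0 hA.pairwise_disjoint hA.parts_isTTSP (hA.cover_erase subset_rfl)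
    hB.pairwise_disjoint hB.parts_isTTSP (hB.cover_erase subset_rfl) hmono' hnn' [((Mode.o, Mode.o, Mode.o, Mode.o), 0)]
  have hds := dstmt_root_P hq0 hq1 (psA.map (·.kind)) (psB.map (·.kind)) _ hadm
  have hpos : 0 < q ^ (2 + 2 * ((1 + psA.length + psB.length) * Fintype.card V)) := pow_pos hq0 _
  refine (mul_nonneg_iff_of_pos_left hpos).1 ?_
  rw [key]
  exact mul_nonneg (pow_nonneg hq0.le _) hds

/-- **`U¹¹ ≥ 0` for every network whose split node is a PARALLEL node**: growing `(E; s', t')` from the parallel core `A ∥ B` by gluing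
further two-terminal series–parallel parts (`FK.IsSpine ps (A ∪ B) s t E s' t'`) keeps `apUpcSplit q E s' t' y z h ≥ 0` for every `h`
monotone on the sub-configurations of `E` not reading `y, z`. [cite: Grimmett2006, §3.8 Thm. (3.90) (pp. 61–62); §3.9 (p. 63)] -/
theorem apUpcSplit_nonneg_of_parallel_core {q : ℝ} (hq0 : 0 < q) (hq1 : q ≤ 1)
    (hA : IsSpine psA {s(y₁, y₂)} y₁ y₂ A s t) (hB : IsSpine psB {s(z₁, z₂)} z₁ z₂ B s t)
    (hy : y₁ ≠ y₂) (hz : z₁ ≠ z₂) (hd : Disjoint A B)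
    (h₁ : ∀ e ∈ (↑A : Set (Sym2 V)), ∀ x ∈ e, x ∈ V₁) (h₂ : ∀ e ∈ (↑B : Set (Sym2 V)), ∀ x ∈ e, x ∈ V₂)
    (hS : V₁ ∩ V₂ ⊆ {s, t}) (hst : s ≠ t)
    {ps : List (SpinePart V)} {E : Finset (Sym2 V)} {s' t' : V} (hsp : IsSpine ps (A ∪ B) s t E s' t')
    {h : Finset (Sym2 V) → ℝ} (hmono : ∀ ⦃C D : Finset (Sym2 V)⦄, C ⊆ D → D ⊆ E → h C ≤ h D)
    (hhy : ∀ C, h (insert s(y₁, y₂) C) = h C) (hhz : ∀ C, h (insert s(z₁, z₂) C) = h C) :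
    0 ≤ apUpcSplit q E s' t' s(y₁, y₂) s(z₁, z₂) h :=
  hsp.apUpcSplit_nonneg hq0 hst (Finset.mem_union_left B (marked_mem hA)) (Finset.mem_union_right A (marked_mem hB))
    (fun _ hmono' hhy' hhz' => apUpcSplit_parallel_core_nonneg hq0 hq1 hA hB hy hz hd h₁ h₂ hS hst hmono' hhy' hhz')
    h hmono hhy hhz

end Core

end TwoSpine

end FK

end Summit.CriticalPhenomena.PercolationContinuityZ3.Theorems

end
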